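import Summits.BirchSwinnertonDyer.BirchSwinnertonDyer.Theses.SignedBalanceX9
import HarnessLib

/-!
# Route `SignedBalanceX9` — the Assembly (the (im)-free separation), kernel-checked

`Summit.BirchSwinnertonDyer.BirchSwinnertonDyer.Theses.SignedBalanceX9.Assembly` :=
`FourTermDefectBalanceX9 → AnalyticMuZeroX9 → TwistedAnalyticMuZeroX9 → PublishedInputsX9 →
IntegralMainConjectureOnClassX9` is PROVED.  At an X9 pair BCS 2025 Thm 1.1.2 (a) (first conjunct of
`PublishedInputsX9`) gives `ch X = (g)`, `ι g = p^k · L_p(f, α)` with `k ∈ ℤ`.  SIGN: a `p`-adic unit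
coefficient of `L_p` forces `0 ≤ k` since `ι g ∈ ℤ_p⟦T⟧` (`defect_nonneg_of_unit_coeff`).  The supply
(α′) gives a BCS-admissible `(d_K, d_F)` whose three twists carry unit coefficients; they are X9 again
(`X9.classX9_of_smul_eq_quadraticTwist`; `d_K d_F` square-free because the primes of `d_F` split in `K`),
so each carries a BCS datum `k_i ≥ 0`; CONSERVATION (`FourTermDefectBalanceX9`): `k + k₁ + k₂ + k₃ = 0`;
hence `k = 0`: the exact generator, i.e. `IntegralMainConjectureOnClassX9` at the pair.

THEOREMS ONLY (no definition, no named fact, no `sorry`); nothing booked — the balance, the two analytic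
`μ = 0` supplies and the published inputs are hypotheses; no summit or leaf is proved (ideator seat
bsd-idea-2 g2, LINE 5).
-/

set_option linter.dupNamespace false
set_option autoImplicit false

noncomputable section

open scoped Classical

open WeierstrassCurve Literature.NumberTheory.EllipticCurves Literature.NumberTheory.EllipticCurves.ModularForms
  Summit.BirchSwinnertonDyer.BirchSwinnertonDyer.Rank1Residual

open Summit.BirchSwinnertonDyer.BirchSwinnertonDyer.Theses.SignedBalanceX9
  (FourTermDefectBalanceX9 AnalyticMuZeroX9 TwistedAnalyticMuZeroX9 PublishedInputsX9 Assembly)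

namespace Summit.BirchSwinnertonDyer.BirchSwinnertonDyer.Rank1Residual

namespace SignedBalance

/-! ### The sign lemma, square-freeness of `d_K d_F`, twist data, and the Assembly -/

/-- **Sign lemma.** If `ι g = p^k · L` with `g ∈ Λ = ℤ_p⟦T⟧` and some coefficient of `L` is a
`p`-adic unit, then `0 ≤ k`. [folklore] -/
theorem defect_nonneg_of_unit_coeff {p : ℕ} [Fact p.Prime] {L : PowerSeries ℚ_[p]}
    {g : IwasawaAlgebra p} {k : ℤ} (hL : ∃ n : ℕ, ‖PowerSeries.coeff n L‖ = 1)
    (hιg : iwasawaToPowerSeries p g = PowerSeries.C ((p : ℚ_[p]) ^ k) * L) : 0 ≤ k := by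
  obtain ⟨n, hn⟩ := hL
  have h1 : ‖PowerSeries.coeff n (iwasawaToPowerSeries p g)‖ ≤ 1 := by
    rw [PowerSeries.coeff_map]
    exact (PowerSeries.coeff n g).norm_le_one
  rw [hιg, PowerSeries.coeff_C_mul, norm_mul, hn, mul_one, Padic.norm_p_zpow] at h1
  by_contra hk
  have hp : (1 : ℝ) < p := by exact_mod_cast (Fact.out : p.Prime).one_lt
  have : (1 : ℝ) < (p : ℝ) ^ (-k) := one_lt_zpow₀ hp (by omega)
  linarith

/-- Square-freeness of `d_K d_F` for a BCS-admissible pair: every prime dividing `d_F` splits in `K`,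
hence does not divide `d_K`. [folklore] -/
theorem squarefree_mul_of_admissible {dK dF : ℤ} (hK : Squarefree dK) (hF : Squarefree dF)
    (h : ∀ ℓ : ℕ, ℓ.Prime → (ℓ : ℤ) ∣ dF → ¬ (ℓ : ℤ) ∣ dK) : Squarefree (dK * dF) := by
  have hcop : Nat.Coprime dK.natAbs dF.natAbs := by
    rw [Nat.coprime_comm]
    refine Nat.coprime_of_dvd fun q hq hqF hqK => ?_
    exact h q hq (Int.natCast_dvd.mpr hqF) (Int.natCast_dvd.mpr hqK)
  rw [← Int.squarefree_natAbs, Int.natAbs_mul, Nat.squarefree_mul hcop]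
  exact ⟨Int.squarefree_natAbs.mpr hK, Int.squarefree_natAbs.mpr hF⟩

/-- From a unit-coefficient certificate of a twist (the tree's `TwistHasUnitCoeff`, orientation
`C • W^d = W'`): an X9 model `W'` of `W^d` with `C' • W' = W^d`, a newform and the BCS datum's sign. -/
theorem twist_data {W : WeierstrassCurve ℚ} [W.IsElliptic] [W.IsGloballyMinimal] {p : ℕ} [Fact p.Prime]
    (hX9 : ClassX9 W p) {d : ℤ} (hd : Squarefree d) (hpd : ¬ (p : ℤ) ∣ d)
    (hU : TwistHasUnitCoeff W p d) :
    ∃ (W' : WeierstrassCurve ℚ) (_ : W'.IsElliptic) (_ : W'.IsGloballyMinimal),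
      (∃ C : VariableChange ℚ, C • W' = W.quadraticTwist (d : ℚ)) ∧ ClassX9 W' p ∧
      ∃ (N' : ℕ) (_ : NeZero N') (f' : CuspForm (CongruenceSubgroup.Gamma0 N') 2), IsNewformOf W' f' ∧
        ∃ n : ℕ, ‖PowerSeries.coeff n (padicLFunction f' (unitRoot W' p : ℚ_[p]))‖ = 1 := by
  obtain ⟨W', i, i', ⟨C, hC⟩, N', iN', f', hf', n, hn⟩ := hU
  have hC' : C⁻¹ • W' = W.quadraticTwist (d : ℚ) := by
    rw [← hC, smul_smul, inv_mul_cancel, one_smul]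
  exact ⟨W', i, i', ⟨C⁻¹, hC'⟩,
    Summit.BirchSwinnertonDyer.Rank1Residual.X9.classX9_of_smul_eq_quadraticTwist W W' p hX9 hd hC' hpd,
    N', iN', f', hf', n, hn⟩

/-- **The glue `Assembly`, proved.** At an X9 pair BCS (a) gives `ch X = (g)`, `ι g = p^k L_p`
(`k ∈ ℤ`); (α′) supplies an admissible `(d_K, d_F)` whose three twists carry unit coefficients; each twist
is X9 again (twist stability; `d_K d_F` is square-free by admissibility) and carries its own BCS datum
`k_i`; the four-term Balance gives `k + k₁ + k₂ + k₃ = 0`; the sign lemma gives `0 ≤ k` (analytic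
`μ = 0` at `W`) and `0 ≤ k_i` (unit coefficients of the twists); hence `k = 0`: the exact generator. -/
theorem signedBalanceX9_assembly : Assembly := by
  intro hBal hMu hTw hPub W _ _ p _ κ γ N _ f hX9 hκ hγ hγ' hf D
  obtain ⟨hBCSa, -, -, -, -, -, -, -⟩ := hPub
  obtain ⟨hX, g, k, hchar, hιg⟩ :=
    hBCSa W p κ γ f hX9.2.1 hX9.2.2.1 hX9.2.2.2.1 hX9.2.2.2.2.1 hκ hγ hγ' hf D
  suffices hk : k = 0 by
    subst hk
    exact ⟨hX, g, hchar, by simpa using hιg⟩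
  have hk0 : 0 ≤ k := defect_nonneg_of_unit_coeff (hMu W p f hX9 hf) hιg
  obtain ⟨dK, dF, hadm, hUK, hUF, hUKF⟩ := hTw W p hX9
  have hp5 : 5 ≤ p := hX9.2.1
  have hpK : ¬ (p : ℤ) ∣ dK := hadm.2.2.1.1
  have hpF : ¬ (p : ℤ) ∣ dF := hadm.2.2.2.2.1.1
  have hsqK : Squarefree dK := hadm.1.2.1
  have hsqF : Squarefree dF := hadm.2.2.2.1.2.1
  have hsqKF : Squarefree (dK * dF) :=
    squarefree_mul_of_admissible hsqK hsqF fun ℓ hℓ hℓF => (hadm.2.2.2.2.2.1 ℓ hℓ hℓF).1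
  have hpKF : ¬ (p : ℤ) ∣ dK * dF := by
    intro h
    rcases (Nat.prime_iff_prime_int.mp (Fact.out : p.Prime)).dvd_mul.mp h with h | h
    · exact hpK h
    · exact hpF h
  -- the three twists
  obtain ⟨W₁, i₁, i₁', hC₁, hX9₁, N₁, iN₁, f₁, hf₁, hn₁⟩ := twist_data hX9 hsqK hpK hUK
  obtain ⟨W₂, i₂, i₂', hC₂, hX9₂, N₂, iN₂, f₂, hf₂, hn₂⟩ := twist_data hX9 hsqF hpF hUF
  obtain ⟨W₃, i₃, i₃', hC₃, hX9₃, N₃, iN₃, f₃, hf₃, hn₃⟩ := twist_data hX9 hsqKF hpKF hUKF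
  haveI := i₁; haveI := i₁'; haveI := iN₁; haveI := i₂; haveI := i₂'; haveI := iN₂
  haveI := i₃; haveI := i₃'; haveI := iN₃
  obtain ⟨D₁⟩ := W₁.nonempty_selmerDualData_holds κ γ hγ
  obtain ⟨D₂⟩ := W₂.nonempty_selmerDualData_holds κ γ hγ
  obtain ⟨D₃⟩ := W₃.nonempty_selmerDualData_holds κ γ hγ
  obtain ⟨-, g₁, k₁, hchar₁, hιg₁⟩ :=
    hBCSa W₁ p κ γ f₁ hX9₁.2.1 hX9₁.2.2.1 hX9₁.2.2.2.1 hX9₁.2.2.2.2.1 hκ hγ hγ' hf₁ D₁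
  obtain ⟨-, g₂, k₂, hchar₂, hιg₂⟩ :=
    hBCSa W₂ p κ γ f₂ hX9₂.2.1 hX9₂.2.2.1 hX9₂.2.2.2.1 hX9₂.2.2.2.2.1 hκ hγ hγ' hf₂ D₂
  obtain ⟨-, g₃, k₃, hchar₃, hιg₃⟩ :=
    hBCSa W₃ p κ γ f₃ hX9₃.2.1 hX9₃.2.2.1 hX9₃.2.2.2.1 hX9₃.2.2.2.2.1 hκ hγ hγ' hf₃ D₃
  have hk1 : 0 ≤ k₁ := defect_nonneg_of_unit_coeff hn₁ hιg₁
  have hk2 : 0 ≤ k₂ := defect_nonneg_of_unit_coeff hn₂ hιg₂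
  have hk3 : 0 ≤ k₃ := defect_nonneg_of_unit_coeff hn₃ hιg₃
  have hsum : k + k₁ + k₂ + k₃ = 0 :=
    hBal W p dK dF hX9 hadm W₁ W₂ W₃ hC₁ hC₂ hC₃ κ γ f f₁ f₂ f₃ hκ hγ hγ' hf hf₁ hf₂ hf₃ D D₁ D₂ D₃
      k k₁ k₂ k₃ ⟨g, hchar, hιg⟩ ⟨g₁, hchar₁, hιg₁⟩ ⟨g₂, hchar₂, hιg₂⟩ ⟨g₃, hchar₃, hιg₃⟩
  omega


/-- The route item, by its fully qualified name. -/
theorem assembly_holds :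
    Summit.BirchSwinnertonDyer.BirchSwinnertonDyer.Theses.SignedBalanceX9.Assembly :=
  signedBalanceX9_assembly

end SignedBalance

end Summit.BirchSwinnertonDyer.BirchSwinnertonDyer.Rank1Residual

end
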